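import Literature.NumberTheory.EllipticCurves.NeronSigmaFunction
import Literature.NumberTheory.EllipticCurves.LangHeightArchEstimateLemma5Proofs
import Literature.NumberTheory.EllipticCurves.WeierstrassZetaLegendre
import Literature.NumberTheory.EllipticCurves.WeierstrassSigmaProofs
import Literature.NumberTheory.EllipticCurves.UniformizationProofs
import HarnessLib

/-!
# ATAEC Thm. VI.3.4 from the `q`-product of `σ`: `neronSigma (ℤτ + ℤ) = neronFunction τ`

Topic `NumberTheory/EllipticCurves` (family `abc`, G06). Pure proofs (theorems only). Companion
of `NeronSigmaFunction.lean`: this file proves **Silverman, *Advanced Topics*, Thm. VI.3.4** in the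
form

> `neronSigma_ofUpperHalfPlane_eq_neronFunction`: assuming the `q`-product expansion of `σ`
> (Thm. I.6.4, the named fact `weierstrassSigma_ofUpperHalfPlane_eq_qProduct` of `NeronSigmaFunction.lean`), for
> every `τ ∈ ℍ` and `z ∉ ℤτ + ℤ`,
> `(PeriodPair.ofUpperHalfPlane τ).neronSigma z = neronFunction τ z`,

i.e. Silverman's `σ`-form `½ Re(zη(z)) − log|σ(z)| − (1/12) log|Δ(Λ)|` of the Néron function
(Thm. VI.3.2) agrees with its `q`-expansion
`−½B₂(Im z/Im τ) log|q| − log|1 − u| − Σ log|(1 − qⁿu)(1 − qⁿu⁻¹)|` (`LangHeightArchEstimate.lean`).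
This is one of the two halves of the decomposition of the named fact
`neronLocalHeight_eq_neronFunction` (ATAEC VI.3.4(b)); the other half — Thm. VI.3.2, that Tate's
series along the analytic parametrisation is `neronSigma` — is the subject of further proof files.

## Proof (ATAEC pp. 466–467)

Write `q = e^{2πiτ}`, `u = e^{2πiz}`, `z = aτ + b` (`a = Im z/Im τ`). Off the lattice all factors
`1 − u`, `1 − qⁿu^{±1}` are non-zero (`qProduct_num_ne_zero`), the logarithms of the factors of the
`q`-product are summable (`summable_log_qProduct_factor`), so the product is `exp Σ log` and
`log|∏ …| = Σ log|(1 − qⁿu)(1 − qⁿu⁻¹)| − 2Σ log|1 − qⁿ|` (`log_norm_qProduct`). With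
`Δ(Λ_τ) = (2π)¹² q ∏(1 − qⁿ)²⁴` (`log_norm_discr_ofUpperHalfPlane`) the `∏(1 − qⁿ)` terms and the
`2π`'s cancel, and Legendre's relation `η(1)τ − η(τ) = 2πi` (the tree's
`PeriodPair.legendre_relation_of_neg`, `η(1) = η₂`, `η(τ) = η₁` for `ofUpperHalfPlane τ = (τ, 1)`)
turns `½Re(zη(z)) − ½Re(η(1)z²) + π Im z` into `πa Im z − π Im z + …`, which is
`−½B₂(a) log|q|` since `log|q| = −2π Im τ` and `Im z = a Im τ`.

## References

* J. H. Silverman, *Advanced Topics in the Arithmetic of Elliptic Curves* (1994), Thm. I.6.4,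
  I.8.1, Prop. VI.3.1, Thm. VI.3.2, Thm. VI.3.4 and its proof (pp. 466–467).
-/

noncomputable section

open scoped UpperHalfPlane Real Topology

open Complex

namespace Literature.NumberTheory.EllipticCurves

open _root_.PeriodPair Literature.NumberTheory.EllipticCurves.ModularForms Filter

section VI34

variable (τ : ℍ)

/-- `e^{2πiw} = 1 ↔ w ∈ ℤ` (Mathlib's `Complex.exp_eq_one_iff`, rescaled). [folklore] -/
theorem cexp_two_pi_I_mul_eq_one_iff (w : ℂ) : cexp (2 * π * I * w) = 1 ↔ ∃ k : ℤ, w = k := by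
  rw [Complex.exp_eq_one_iff]
  have h2 : (2 * π * I : ℂ) ≠ 0 := by
    apply mul_ne_zero (mul_ne_zero two_ne_zero (Complex.ofReal_ne_zero.mpr Real.pi_ne_zero)) I_ne_zero
  constructor
  · rintro ⟨k, hk⟩
    refine ⟨k, ?_⟩
    have : 2 * π * I * w = 2 * π * I * k := by rw [hk]; ring
    exact mul_left_cancel₀ h2 this
  · rintro ⟨k, rfl⟩
    exact ⟨k, by ring⟩

variable {τ}

/-- Off the lattice `ℤτ + ℤ`: `e^{2πi(nτ + z)} ≠ 1` for every `n ∈ ℤ` (else `z ∈ ℤ − nτ`).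
[folklore] -/
theorem one_sub_cexp_ne_zero_of_notMem {z : ℂ} (hz : z ∉ (ofUpperHalfPlane τ).lattice) (n : ℤ) :
    1 - cexp (2 * π * I * (n * (τ : ℂ) + z)) ≠ 0 := by
  intro h
  rw [sub_eq_zero, eq_comm, cexp_two_pi_I_mul_eq_one_iff] at h
  obtain ⟨k, hk⟩ := h
  apply hz
  rw [mem_lattice]
  refine ⟨-n, k, ?_⟩
  rw [ofUpperHalfPlane_ω₁, ofUpperHalfPlane_ω₂]
  push_cast
  linear_combination -hk

/-- `qⁿ⁺¹ u = e^{2πi((n+1)τ + z)}`. [folklore] -/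
theorem qpow_mul_u_eq (z : ℂ) (n : ℕ) :
    cexp (2 * π * I * τ) ^ (n + 1) * cexp (2 * π * I * z) =
      cexp (2 * π * I * (((n + 1 : ℕ) : ℤ) * (τ : ℂ) + z)) := by
  rw [← Complex.exp_nat_mul, ← Complex.exp_add]
  congr 1
  push_cast
  ring

/-- `qⁿ⁺¹ u⁻¹ = e^{2πi((n+1)τ − z)}`. [folklore] -/
theorem qpow_mul_u_inv_eq (z : ℂ) (n : ℕ) :
    cexp (2 * π * I * τ) ^ (n + 1) * (cexp (2 * π * I * z))⁻¹ =
      cexp (2 * π * I * (((n + 1 : ℕ) : ℤ) * (τ : ℂ) + -z)) := by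
  rw [← Complex.exp_nat_mul, ← Complex.exp_neg, ← Complex.exp_add]
  congr 1
  push_cast
  ring

/-- The numerators `(1 − qⁿ⁺¹u)(1 − qⁿ⁺¹u⁻¹)` of the `q`-product are non-zero off the lattice
(the zeros of `σ` are exactly the lattice points). [folklore] -/
theorem qProduct_num_ne_zero {z : ℂ} (hz : z ∉ (ofUpperHalfPlane τ).lattice) (n : ℕ) :
    (1 - cexp (2 * π * I * τ) ^ (n + 1) * cexp (2 * π * I * z)) *
      (1 - cexp (2 * π * I * τ) ^ (n + 1) * (cexp (2 * π * I * z))⁻¹) ≠ 0 := by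
  have hz' : -z ∉ (ofUpperHalfPlane τ).lattice := fun h => hz (by simpa using neg_mem h)
  refine mul_ne_zero ?_ ?_
  · rw [qpow_mul_u_eq]; exact one_sub_cexp_ne_zero_of_notMem hz _
  · rw [qpow_mul_u_inv_eq]; exact one_sub_cexp_ne_zero_of_notMem hz' _

/-- `1 − u ≠ 0` off the lattice (`u = 1` iff `z ∈ ℤ`). [folklore] -/
theorem one_sub_u_ne_zero {z : ℂ} (hz : z ∉ (ofUpperHalfPlane τ).lattice) :
    1 - cexp (2 * π * I * z) ≠ 0 := by
  have := one_sub_cexp_ne_zero_of_notMem hz 0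
  simpa using this

/-- `1 − qⁿ⁺¹ ≠ 0` (`|q| < 1`). [folklore] -/
theorem one_sub_qpow_ne_zero (τ : ℍ) (n : ℕ) : 1 - cexp (2 * π * I * τ) ^ (n + 1) ≠ 0 :=
  one_sub_pow_succ_ne_zero (UpperHalfPlane.norm_exp_two_pi_I_lt_one τ) n

/-- The factor of the `q`-product minus one: `(1 − qu)(1 − qu⁻¹)/(1 − q)² − 1 = q(2 − u − u⁻¹)/(1 − q)²`.
[folklore] -/
theorem qProduct_factor_sub_one (q u : ℂ) (hu : u ≠ 0) (hq : 1 - q ≠ 0) :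
    (1 - q * u) * (1 - q * u⁻¹) / (1 - q) ^ 2 - 1 = q * (2 - u - u⁻¹) / (1 - q) ^ 2 := by
  field_simp
  ring

/-- **The logarithms of the factors of the `q`-product are summable** (for every `z`): the
factor is `1 + gₙ` with `‖gₙ‖ ≤ ‖2 − u − u⁻¹‖ (1 − |q|)⁻² |q|ⁿ⁺¹`, so Mathlib's
`Complex.summable_log_one_add_of_summable` applies (ATAEC, proof of Thm. I.6.4: "for all but
finitely many `n`, `|log(1 − qⁿu^{±1})| ≤ 2|qⁿu^{±1}|`, hence the series will converge").
[cite: Silverman1994, Thm I.6.4] -/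
theorem summable_log_qProduct_factor (τ : ℍ) (z : ℂ) :
    Summable fun n : ℕ => Complex.log ((1 - cexp (2 * π * I * τ) ^ (n + 1) * cexp (2 * π * I * z)) *
      (1 - cexp (2 * π * I * τ) ^ (n + 1) * (cexp (2 * π * I * z))⁻¹) /
      (1 - cexp (2 * π * I * τ) ^ (n + 1)) ^ 2) := by
  set q := cexp (2 * π * I * τ) with hq
  set u := cexp (2 * π * I * z) with hu
  have hq1 : ‖q‖ < 1 := UpperHalfPlane.norm_exp_two_pi_I_lt_one τ
  have hq0 : 0 ≤ ‖q‖ := norm_nonneg _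
  have hu0 : u ≠ 0 := exp_ne_zero _
  set g : ℕ → ℂ := fun n => q ^ (n + 1) * (2 - u - u⁻¹) / (1 - q ^ (n + 1)) ^ 2 with hg
  have hfg : ∀ n : ℕ, (1 - q ^ (n + 1) * u) * (1 - q ^ (n + 1) * u⁻¹) / (1 - q ^ (n + 1)) ^ 2 =
      1 + g n := by
    intro n
    have := qProduct_factor_sub_one (q ^ (n + 1)) u hu0 (one_sub_qpow_ne_zero τ n)
    rw [hg]
    linear_combination this
  simp_rw [hfg]
  apply Complex.summable_log_one_add_of_summable
  -- `‖g n‖ ≤ C ‖q‖ⁿ⁺¹`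
  have hden : ∀ n : ℕ, 1 - ‖q‖ ≤ ‖1 - q ^ (n + 1)‖ := by
    intro n
    have h1 := norm_sub_norm_le (1 : ℂ) (q ^ (n + 1))
    rw [norm_one, norm_pow] at h1
    have h2 : ‖q‖ ^ (n + 1) ≤ ‖q‖ := pow_le_of_le_one hq0 hq1.le (Nat.succ_ne_zero n)
    linarith
  have hpos : 0 < 1 - ‖q‖ := by linarith
  refine Summable.of_norm_bounded (g := fun n : ℕ => ‖2 - u - u⁻¹‖ / (1 - ‖q‖) ^ 2 * ‖q‖ ^ (n + 1))
    (((summable_nat_add_iff (f := fun n : ℕ => ‖q‖ ^ n) 1).mpr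
      (summable_geometric_of_lt_one hq0 hq1)).mul_left _) fun n => ?_
  rw [hg]
  simp only [norm_div, norm_mul, norm_pow]
  rw [div_le_iff₀ (pow_pos (lt_of_lt_of_le hpos (hden n)) 2)]
  have hd2 : (1 - ‖q‖) ^ 2 ≤ ‖1 - q ^ (n + 1)‖ ^ 2 := pow_le_pow_left₀ hpos.le (hden n) 2
  have hnum : 0 ≤ ‖q‖ ^ (n + 1) * ‖2 - u - u⁻¹‖ := by positivity
  calc ‖q‖ ^ (n + 1) * ‖2 - u - u⁻¹‖
      = ‖2 - u - u⁻¹‖ / (1 - ‖q‖) ^ 2 * ‖q‖ ^ (n + 1) * (1 - ‖q‖) ^ 2 := by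
        field_simp
    _ ≤ ‖2 - u - u⁻¹‖ / (1 - ‖q‖) ^ 2 * ‖q‖ ^ (n + 1) * ‖1 - q ^ (n + 1)‖ ^ 2 := by
        apply mul_le_mul_of_nonneg_left hd2
        positivity

/-- **The modulus of the `q`-product**, off the lattice:
`log|∏_{n≥1} (1 − qⁿu)(1 − qⁿu⁻¹)/(1 − qⁿ)²| = Σ_{n≥1} log|(1 − qⁿu)(1 − qⁿu⁻¹)| − 2 Σ_{n≥1} log|1 − qⁿ|`
(the product is `exp` of the convergent sum of logarithms, `Complex.cexp_tsum_eq_tprod`; both series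
on the right converge, `summable_neronFunction_term` and the real part of
`summable_log_one_sub_pow`). [folklore] -/
theorem log_norm_qProduct {z : ℂ} (hz : z ∉ (ofUpperHalfPlane τ).lattice) :
    Real.log ‖∏' n : ℕ, (1 - cexp (2 * π * I * τ) ^ (n + 1) * cexp (2 * π * I * z)) *
      (1 - cexp (2 * π * I * τ) ^ (n + 1) * (cexp (2 * π * I * z))⁻¹) /
      (1 - cexp (2 * π * I * τ) ^ (n + 1)) ^ 2‖ =
    (∑' n : ℕ, Real.log ‖(1 - cexp (2 * π * I * τ) ^ (n + 1) * cexp (2 * π * I * z)) *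
      (1 - cexp (2 * π * I * τ) ^ (n + 1) * (cexp (2 * π * I * z))⁻¹)‖) -
    2 * ∑' n : ℕ, Real.log ‖1 - cexp (2 * π * I * τ) ^ (n + 1)‖ := by
  set q := cexp (2 * π * I * τ) with hq
  set u := cexp (2 * π * I * z) with hu
  have hq1 : ‖q‖ < 1 := UpperHalfPlane.norm_exp_two_pi_I_lt_one τ
  set f : ℕ → ℂ := fun n => (1 - q ^ (n + 1) * u) * (1 - q ^ (n + 1) * u⁻¹) / (1 - q ^ (n + 1)) ^ 2
    with hf
  have hf0 : ∀ n, f n ≠ 0 := fun n =>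
    div_ne_zero (qProduct_num_ne_zero hz n) (pow_ne_zero 2 (one_sub_qpow_ne_zero τ n))
  have hsum : Summable fun n => Complex.log (f n) := summable_log_qProduct_factor τ z
  have hprod : ∏' n, f n = cexp (∑' n, Complex.log (f n)) := (Complex.cexp_tsum_eq_tprod hf0 hsum).symm
  have h1 : Summable fun n : ℕ => Real.log ‖(1 - q ^ (n + 1) * u) * (1 - q ^ (n + 1) * u⁻¹)‖ :=
    summable_neronFunction_term τ z
  have h2 : Summable fun n : ℕ => Real.log ‖1 - q ^ (n + 1)‖ := by
    have := (Complex.hasSum_re (summable_log_one_sub_pow hq1).hasSum).summable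
    simpa only [Complex.log_re] using this
  have hterm : ∀ n : ℕ, (Complex.log (f n)).re =
      Real.log ‖(1 - q ^ (n + 1) * u) * (1 - q ^ (n + 1) * u⁻¹)‖ - 2 * Real.log ‖1 - q ^ (n + 1)‖ := by
    intro n
    rw [Complex.log_re, hf]
    simp only [norm_div, norm_pow]
    rw [Real.log_div (norm_ne_zero_iff.mpr (qProduct_num_ne_zero hz n))
      (pow_ne_zero 2 (norm_ne_zero_iff.mpr (one_sub_qpow_ne_zero τ n))), Real.log_pow]
    push_cast
    ring
  show Real.log ‖∏' n, f n‖ = _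
  rw [hprod, norm_exp, Real.log_exp, Complex.re_tsum hsum]
  simp_rw [hterm]
  rw [Summable.tsum_sub h1 (h2.mul_left 2), tsum_mul_left]

/-- **The modulus of `Δ(Λ_τ)`**: `log|g₂(Λ_τ)³ − 27g₃(Λ_τ)²| = 12 log(2π) + log|q| + 24 Σ_{n≥1} log|1 − qⁿ|`,
from `Δ(Λ_τ) = (2π)¹² Δ(τ)` (`PeriodPair.discr_ofUpperHalfPlane`) and the product expansion
`Δ(τ) = q ∏ (1 − qⁿ)²⁴` (Mathlib `ModularForm.discriminant_eq_q_prod`; ATAEC I.8.1).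
[cite: Silverman1994, Thm VI.3.4] -/
theorem log_norm_discr_ofUpperHalfPlane (τ : ℍ) :
    Real.log ‖(ofUpperHalfPlane τ).g₂ ^ 3 - 27 * (ofUpperHalfPlane τ).g₃ ^ 2‖ =
      12 * Real.log (2 * π) + Real.log ‖cexp (2 * π * I * τ)‖ +
        24 * ∑' n : ℕ, Real.log ‖1 - cexp (2 * π * I * τ) ^ (n + 1)‖ := by
  have hq1 : ‖cexp (2 * π * I * τ)‖ < 1 := UpperHalfPlane.norm_exp_two_pi_I_lt_one τ
  have hsL := summable_log_one_sub_pow hq1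
  have hprod : ∏' n : ℕ, (1 - cexp (2 * π * I * τ) ^ (n + 1)) ^ 24 =
      cexp (24 * ∑' n : ℕ, Complex.log (1 - cexp (2 * π * I * τ) ^ (n + 1))) := by
    rw [(ModularForm.multipliable_one_sub_pow hq1).tprod_pow, ← cexp_tsum_log_one_sub_pow hq1,
      ← Complex.exp_nat_mul]
    norm_num
  have hΔ : ModularForm.discriminant τ =
      cexp (2 * π * I * τ) * ∏' n : ℕ, (1 - cexp (2 * π * I * τ) ^ (n + 1)) ^ 24 := by
    rw [← qParam_one_eq_cexp]
    exact ModularForm.discriminant_eq_q_prod τ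
  have hre : (24 * ∑' n : ℕ, Complex.log (1 - cexp (2 * π * I * τ) ^ (n + 1))).re =
      24 * ∑' n : ℕ, Real.log ‖1 - cexp (2 * π * I * τ) ^ (n + 1)‖ := by
    rw [show (24 : ℂ) = ((24 : ℝ) : ℂ) by norm_num, Complex.re_ofReal_mul, Complex.re_tsum hsL]
    simp only [Complex.log_re]
  have h2π : (0 : ℝ) < 2 * π := by positivity
  have hn2π : ‖(2 * (π : ℂ)) ^ 12‖ = (2 * π) ^ 12 := by
    rw [norm_pow, norm_mul, Complex.norm_real, Complex.norm_ofNat, Real.norm_eq_abs,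
      abs_of_pos Real.pi_pos]
  have hq0 : ‖cexp (2 * π * I * τ)‖ ≠ 0 := (norm_pos_iff.mpr (exp_ne_zero _)).ne'
  rw [discr_ofUpperHalfPlane, hΔ, hprod, norm_mul, hn2π, norm_mul,
    Complex.norm_exp (24 * ∑' n : ℕ, Complex.log (1 - cexp (2 * π * I * τ) ^ (n + 1))),
    Real.log_mul (pow_ne_zero _ h2π.ne') (mul_ne_zero hq0 (Real.exp_pos _).ne'),
    Real.log_mul hq0 (Real.exp_pos _).ne', Real.log_pow, Real.log_exp, hre]
  push_cast
  ring

/-- **Silverman ATAEC Thm. VI.3.4 from Thm. I.6.4** (the printed proof, pp. 466–467): for `τ ∈ ℍ`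
and `z ∉ ℤτ + ℤ`, the `σ`-form of the Néron function of `Λ_τ = ℤτ + ℤ` (Thm. VI.3.2,
`PeriodPair.neronSigma`) equals the `q`-expansion `neronFunction τ z`:
writing `z = aτ + b`, the `q`-product of `σ` (Thm. I.6.4, hypothesis `h64`),
`|Δ(Λ_τ)|^{1/12} = 2π |q|^{1/12} ∏|1 − qⁿ|²` and Legendre's relation `τη(1) − η(τ) = 2πi`
(`PeriodPair.legendre_relation_of_neg`: `η(z) = aη(τ) + bη(1)`, so `zη(z) = η(1)z² − 2πi a z`)
give `|e^{−½zη(z)} σ(z) Δ^{1/12}| = |q|^{½(a² − a + 1/6)} |1 − u| ∏|(1 − qⁿu)(1 − qⁿu⁻¹)|`, and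
`Im z = a Im τ`. (On the lattice both sides are junk and the identity is not claimed.)
[cite: Silverman1994, Thm VI.3.4] -/
theorem neronSigma_ofUpperHalfPlane_eq_neronFunction
    (h64 : weierstrassSigma_ofUpperHalfPlane_eq_qProduct) {τ : ℍ} {z : ℂ}
    (hz : z ∉ (ofUpperHalfPlane τ).lattice) :
    (ofUpperHalfPlane τ).neronSigma z = neronFunction τ z := by
  set L := ofUpperHalfPlane τ with hL
  set q := cexp (2 * π * I * τ) with hq
  set u := cexp (2 * π * I * z) with hu
  set a : ℝ := z.im / τ.im with ha
  set b : ℝ := z.re - z.im / τ.im * τ.re with hb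
  have hτ0 : τ.im ≠ 0 := τ.im_pos.ne'
  have hzab : z = (a : ℂ) * (τ : ℂ) + (b : ℂ) := by
    have := re_sub_add_im_div_mul τ z
    rw [← this, ha, hb]
    ring
  have hzim : z.im = a * τ.im := by rw [ha]; field_simp
  -- quasi-period part
  have hleg : L.η₂ * (τ : ℂ) - L.η₁ = 2 * π * I := by
    have h := L.legendre_relation_of_neg (by simp [hL, UpperHalfPlane.im_pos])
    simpa [hL] using h
  have hη : L.quasiPeriodMap z = (a : ℂ) * L.η₁ + (b : ℂ) * L.η₂ := by
    have := L.quasiPeriodMap_smul_add_smul a b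
    simp only [hL, ofUpperHalfPlane_ω₁, ofUpperHalfPlane_ω₂, mul_one] at this ⊢
    rw [← this, hzab]
  have hzη : z * L.quasiPeriodMap z = L.η₂ * z ^ 2 - 2 * π * I * a * z := by
    rw [hη]
    have : (a : ℂ) * L.η₁ + (b : ℂ) * L.η₂ = L.η₂ * z - a * (L.η₂ * (τ : ℂ) - L.η₁) := by
      rw [hzab]; ring
    rw [this, hleg]
    ring
  have hre1 : (z * L.quasiPeriodMap z).re = (L.η₂ * z ^ 2).re + 2 * π * a * z.im := by
    rw [hzη, Complex.sub_re]
    have : (2 * (π : ℂ) * I * (a : ℂ) * z).re = -(2 * π * a * z.im) := by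
      simp [Complex.mul_re, Complex.mul_im]
    rw [this]
    ring
  -- sigma part
  set P := ∏' n : ℕ, (1 - q ^ (n + 1) * u) * (1 - q ^ (n + 1) * u⁻¹) / (1 - q ^ (n + 1)) ^ 2
    with hP
  have hσ : L.weierstrassSigma z =
      -(1 / (2 * π * I)) * cexp (1 / 2 * L.η₂ * z ^ 2) * cexp (-(π * I * z)) * (1 - u) * P :=
    h64 τ z
  have hσ0 : L.weierstrassSigma z ≠ 0 := weierstrassSigma_ne_zero L hz
  have hP0 : P ≠ 0 := by
    intro h0
    apply hσ0
    rw [hσ, h0, mul_zero]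
  have hu1 : 1 - u ≠ 0 := one_sub_u_ne_zero hz
  have h2πI : ‖-(1 / (2 * (π : ℂ) * I))‖ = 1 / (2 * π) := by
    rw [norm_neg, norm_div, norm_one]
    simp [Complex.norm_real, abs_of_pos Real.pi_pos]
  have hnσ : ‖L.weierstrassSigma z‖ =
      1 / (2 * π) * Real.exp ((1 / 2 * L.η₂ * z ^ 2).re) * Real.exp (π * z.im) * ‖1 - u‖ * ‖P‖ := by
    rw [hσ, norm_mul, norm_mul, norm_mul, norm_mul, h2πI, norm_exp, norm_exp]
    congr 2
    congr 1
    simp [Complex.mul_re]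
  have hlogσ : Real.log ‖L.weierstrassSigma z‖ =
      -Real.log (2 * π) + (1 / 2 * L.η₂ * z ^ 2).re + π * z.im + Real.log ‖1 - u‖ + Real.log ‖P‖ := by
    have h1 : (0 : ℝ) < 1 / (2 * π) := by positivity
    have h2 : 0 < Real.exp ((1 / 2 * L.η₂ * z ^ 2).re) := Real.exp_pos _
    have h3 : 0 < Real.exp (π * z.im) := Real.exp_pos _
    have h4 : 0 < ‖1 - u‖ := norm_pos_iff.mpr hu1
    have h5 : 0 < ‖P‖ := norm_pos_iff.mpr hP0
    rw [hnσ, Real.log_mul (by positivity) h5.ne', Real.log_mul (by positivity) h4.ne',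
      Real.log_mul (by positivity) h3.ne', Real.log_mul h1.ne' h2.ne', Real.log_exp, Real.log_exp,
      one_div, Real.log_inv]
  have hlogP := log_norm_qProduct (τ := τ) hz
  -- assemble
  have hΔ := log_norm_discr_ofUpperHalfPlane τ
  have hlogq : Real.log ‖q‖ = -(2 * π * τ.im) := by
    rw [hq, log_norm_cexp_two_pi_I_mul, UpperHalfPlane.coe_im]
  have hre2 : (1 / 2 * L.η₂ * z ^ 2).re = 1 / 2 * (L.η₂ * z ^ 2).re := by
    have : (1 / 2 * L.η₂ * z ^ 2) = ((1 / 2 : ℝ) : ℂ) * (L.η₂ * z ^ 2) := by push_cast; ring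
    rw [this, Complex.re_ofReal_mul]
  rw [neronSigma_def, neronFunction, hre1, hlogσ, hre2, hΔ, bernoulliTwo]
  simp only [← hq, ← hu, ← hP] at hlogP ⊢
  rw [hlogP, hlogq, hzim]
  field_simp
  ring

end VI34

end Literature.NumberTheory.EllipticCurves

end
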